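import Summits.QuantumFields.YangMills.Theorems.LuscherReductionRunningReductionCombGaugeBox
import Summits.QuantumFields.YangMills.Theorems.FemtoTransferGapRungW1upAlgebra
import HarnessLib

/-!
# `L`-th powers separate near the identity: `‖a^n − b^n‖_F ≥ n(1 − (n−1)δ)·‖a − b‖_F` on `SU(2)` for `a, b` within `δ` of `1` — the second geometric input of the far-pair kernel
# estimate (K-far) of hT at rate
# (route `FlatTubeReduction`, crux K1 `NearFlatRatioLaw` stmt-QuantumFields-24720; seat `ym-line-ftr-p1` g14; rate twin «ratepack-v3 / frozen fibres»; R2b1 RECORD rung — no summit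
# statement is proved here)

WHY (memo `Cruxes/NearFlatRatioLaw/Lines/ratepack-v3-frozen-g12.md` §8.3).  `…PolyakovPairSeparation.exists_site_conj_powers_le` bounds `Σ_e ‖U_e − (V^g)_e‖_F` from below by
`L²·Σ_k ‖u_k^L − c·u'_k^L·c⁻¹‖_F` (some `c = g(x)`); to turn the `L`-th powers back into the slow pair distance `Σ_k ‖u_k − c u'_k c⁻¹‖_F` one needs the elementary expansion
`a^n − b^n = Σ_j a^j(a − b)b^{n−1−j} = n(a − b) + O(n(n−1)δ‖a − b‖)` for `a, b` within `δ` of `1` (the slow window has `L·δ ≪ 1`):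
* `frobNorm_pow_sub_one_le` — `‖b^n − 1‖_F ≤ n‖b − 1‖_F`;
* `frobNorm_pow_sub_pow_sub_smul_le` — `‖(a^n − b^n) − n·(a − b)‖_F ≤ n(n−1)δ‖a − b‖_F`;
* ★ `frobNorm_pow_sub_pow_ge` — `n(1 − (n−1)δ)‖a − b‖_F ≤ ‖a^n − b^n‖_F`;  ★ `frobNorm_pow_sub_conj_pow_ge` — the same with `b = c u' c⁻¹`:
  `n(1 − (n−1)δ)‖u − c u' c⁻¹‖_F ≤ ‖u^n − c u'^n c⁻¹‖_F`.
HONEST FRAMING: matrix inequalities; femto rung R2b1 (RECORD label); not infinite volume, not a gap, not Clay.  No defs, no named facts, no `sorry`.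
-/

set_option autoImplicit false

noncomputable section

open scoped BigOperators
open Literature.MathematicalPhysics.QuantumFieldTheory
open Literature.MathematicalPhysics.QuantumLattice

namespace Summit.QuantumFields.YangMills.Theorems.FemtoTransferGap.TwoLattice.ConstTube

open Summit.QuantumFields.YangMills.Theorems.FemtoTransferGap

/-- `‖b^n − 1‖_F ≤ n‖b − 1‖_F` on `SU(2)`. [folklore] -/
theorem frobNorm_pow_sub_one_le (b : SU2) (n : ℕ) :
    frobNorm (((b ^ n : SU2) : Matrix (Fin 2) (Fin 2) ℂ) - 1) ≤ n * frobNorm ((b : Matrix (Fin 2) (Fin 2) ℂ) - 1) := by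
  induction n with
  | zero => simp [frobNorm_zero]
  | succ n ih =>
    rw [pow_succ]
    refine (frobNorm_mul_sub_one_le _ _).trans ?_
    push_cast at ih ⊢; linarith

/-- The expansion to first order: `‖(a^n − b^n) − n·(a − b)‖_F ≤ n(n−1)·δ·‖a − b‖_F` for `‖a − 1‖_F, ‖b − 1‖_F ≤ δ`. [folklore] -/
theorem frobNorm_pow_sub_pow_sub_smul_le (a b : SU2) {δ : ℝ} (ha : frobNorm ((a : Matrix (Fin 2) (Fin 2) ℂ) - 1) ≤ δ)
    (hb : frobNorm ((b : Matrix (Fin 2) (Fin 2) ℂ) - 1) ≤ δ) (n : ℕ) :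
    frobNorm ((((a ^ n : SU2) : Matrix (Fin 2) (Fin 2) ℂ) - ((b ^ n : SU2) : Matrix (Fin 2) (Fin 2) ℂ)) -
        (n : ℂ) • ((a : Matrix (Fin 2) (Fin 2) ℂ) - (b : Matrix (Fin 2) (Fin 2) ℂ))) ≤
      n * ((n : ℝ) - 1) * δ * frobNorm ((a : Matrix (Fin 2) (Fin 2) ℂ) - (b : Matrix (Fin 2) (Fin 2) ℂ)) := by
  set A : Matrix (Fin 2) (Fin 2) ℂ := (a : Matrix (Fin 2) (Fin 2) ℂ) with hA
  set B : Matrix (Fin 2) (Fin 2) ℂ := (b : Matrix (Fin 2) (Fin 2) ℂ) with hB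
  have hδ0 : 0 ≤ δ := (frobNorm_nonneg _).trans ha
  have hD0 : 0 ≤ frobNorm (A - B) := frobNorm_nonneg _
  induction n with
  | zero => simp [frobNorm_zero]
  | succ n ih =>
    -- `E_{n+1} = a·E_n + n(a − 1)(a − b) + (a − b)(b^n − 1)`
    have e : (((a ^ (n + 1) : SU2) : Matrix (Fin 2) (Fin 2) ℂ) - ((b ^ (n + 1) : SU2) : Matrix (Fin 2) (Fin 2) ℂ)) - ((n + 1 : ℕ) : ℂ) • (A - B) =
        A * ((((a ^ n : SU2) : Matrix (Fin 2) (Fin 2) ℂ) - ((b ^ n : SU2) : Matrix (Fin 2) (Fin 2) ℂ)) - (n : ℂ) • (A - B)) +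
          ((n : ℂ) • ((A - 1) * (A - B)) + (A - B) * (((b ^ n : SU2) : Matrix (Fin 2) (Fin 2) ℂ) - 1)) := by
      rw [pow_succ', pow_succ']
      push_cast
      rw [hA, hB]
      simp only [Matrix.mul_sub, Matrix.sub_mul, Matrix.mul_smul, Matrix.one_mul, Matrix.mul_one, add_smul, one_smul, smul_sub]
      abel
    rw [e]
    have hunit : frobNorm (A * ((((a ^ n : SU2) : Matrix (Fin 2) (Fin 2) ℂ) - ((b ^ n : SU2) : Matrix (Fin 2) (Fin 2) ℂ)) - (n : ℂ) • (A - B))) =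
        frobNorm ((((a ^ n : SU2) : Matrix (Fin 2) (Fin 2) ℂ) - ((b ^ n : SU2) : Matrix (Fin 2) (Fin 2) ℂ)) - (n : ℂ) • (A - B)) :=
      frobNorm_unitary_mul (su2_mem_unitaryGroup a) _
    have h2 : frobNorm ((n : ℂ) • ((A - 1) * (A - B))) ≤ n * (δ * frobNorm (A - B)) := by
      rw [frobNorm_smul, Complex.norm_natCast]
      exact mul_le_mul_of_nonneg_left ((frobNorm_mul_le' _ _).trans (mul_le_mul_of_nonneg_right ha hD0)) (Nat.cast_nonneg n)
    have h3 : frobNorm ((A - B) * (((b ^ n : SU2) : Matrix (Fin 2) (Fin 2) ℂ) - 1)) ≤ frobNorm (A - B) * (n * δ) := by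
      refine (frobNorm_mul_le' _ _).trans (mul_le_mul_of_nonneg_left ?_ hD0)
      exact (frobNorm_pow_sub_one_le b n).trans (mul_le_mul_of_nonneg_left hb (Nat.cast_nonneg n))
    have t1 := frobNorm_add_le' (A * ((((a ^ n : SU2) : Matrix (Fin 2) (Fin 2) ℂ) - ((b ^ n : SU2) : Matrix (Fin 2) (Fin 2) ℂ)) - (n : ℂ) • (A - B)))
      ((n : ℂ) • ((A - 1) * (A - B)) + (A - B) * (((b ^ n : SU2) : Matrix (Fin 2) (Fin 2) ℂ) - 1))
    have t2 := frobNorm_add_le' ((n : ℂ) • ((A - 1) * (A - B))) ((A - B) * (((b ^ n : SU2) : Matrix (Fin 2) (Fin 2) ℂ) - 1))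
    rw [hunit] at t1
    rw [Nat.cast_succ]
    nlinarith [t1, t2, h2, h3, ih, hδ0, hD0]

/-- ★ **Powers separate**: `n(1 − (n−1)δ)·‖a − b‖_F ≤ ‖a^n − b^n‖_F` for `a, b ∈ SU(2)` within `δ` of `1`. [folklore] -/
theorem frobNorm_pow_sub_pow_ge (a b : SU2) {δ : ℝ} (ha : frobNorm ((a : Matrix (Fin 2) (Fin 2) ℂ) - 1) ≤ δ) (hb : frobNorm ((b : Matrix (Fin 2) (Fin 2) ℂ) - 1) ≤ δ) (n : ℕ) :
    n * (1 - ((n : ℝ) - 1) * δ) * frobNorm ((a : Matrix (Fin 2) (Fin 2) ℂ) - (b : Matrix (Fin 2) (Fin 2) ℂ)) ≤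
      frobNorm (((a ^ n : SU2) : Matrix (Fin 2) (Fin 2) ℂ) - ((b ^ n : SU2) : Matrix (Fin 2) (Fin 2) ℂ)) := by
  have hE := frobNorm_pow_sub_pow_sub_smul_le a b ha hb n
  set P : Matrix (Fin 2) (Fin 2) ℂ := ((a ^ n : SU2) : Matrix (Fin 2) (Fin 2) ℂ) - ((b ^ n : SU2) : Matrix (Fin 2) (Fin 2) ℂ) with hP
  set D : Matrix (Fin 2) (Fin 2) ℂ := (a : Matrix (Fin 2) (Fin 2) ℂ) - (b : Matrix (Fin 2) (Fin 2) ℂ) with hD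
  have hsm : frobNorm ((n : ℂ) • D) = n * frobNorm D := by rw [frobNorm_smul, Complex.norm_natCast]
  -- `n‖D‖ = ‖nD‖ ≤ ‖P‖ + ‖P − nD‖`
  have htri : frobNorm ((n : ℂ) • D) ≤ frobNorm P + frobNorm (P - (n : ℂ) • D) := by
    have h := frobNorm_add_le' P (-(P - (n : ℂ) • D))
    rw [show P + -(P - (n : ℂ) • D) = (n : ℂ) • D by abel, frobNorm_neg] at h
    exact h
  rw [hsm] at htri
  nlinarith [htri, hE, frobNorm_nonneg D]

/-- ★ **Powers separate, conjugated form**: `n(1 − (n−1)δ)·‖u − c·u'·c⁻¹‖_F ≤ ‖u^n − c·u'^n·c⁻¹‖_F` for `u, u'` within `δ` of `1`. [folklore] -/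
theorem frobNorm_pow_sub_conj_pow_ge (u u' c : SU2) {δ : ℝ} (hu : frobNorm ((u : Matrix (Fin 2) (Fin 2) ℂ) - 1) ≤ δ) (hu' : frobNorm ((u' : Matrix (Fin 2) (Fin 2) ℂ) - 1) ≤ δ)
    (n : ℕ) :
    n * (1 - ((n : ℝ) - 1) * δ) * frobNorm ((u : Matrix (Fin 2) (Fin 2) ℂ) - ((c * u' * c⁻¹ : SU2) : Matrix (Fin 2) (Fin 2) ℂ)) ≤
      frobNorm (((u ^ n : SU2) : Matrix (Fin 2) (Fin 2) ℂ) - ((c * u' ^ n * c⁻¹ : SU2) : Matrix (Fin 2) (Fin 2) ℂ)) := by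
  have hb : frobNorm (((c * u' * c⁻¹ : SU2) : Matrix (Fin 2) (Fin 2) ℂ) - 1) ≤ δ := by rw [frobNorm_conj_sub_one]; exact hu'
  have h := frobNorm_pow_sub_pow_ge u (c * u' * c⁻¹) hu hb n
  rwa [conj_pow] at h

end Summit.QuantumFields.YangMills.Theorems.FemtoTransferGap.TwoLattice.ConstTube

end
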